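import Summits.QuantumAdvantage.QuantumAdvantage.Theorems.SosSandwichPseudoBoundedAAClassicalCornerL2OSSSLowerBound
import Summits.QuantumAdvantage.QuantumAdvantage.Theorems.SosSandwichPseudoBoundedAAClassicalCornerBlockCalculus
import HarnessLib

/-!
# Crux `PseudoBoundedAA` (stmt-QuantumAdvantage-15237, route SosSandwich) — the GATED-COMPOSITION (soft-address) family
# for the `L²`-OSSS constant: block sums of its two building blocks (the two-selector gadget `G₂` on `{0,1}^4` and the
# three-bit soft selector on `{0,1}^3`)

Support file (`--supports stmt-QuantumAdvantage-15237`, def-free), sequel of `…ClassicalCornerL2OSSSLowerBound` (`C₀ ≥ 8/7`)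
and `…ClassicalCornerBlockCalculus` (Fubini / block-embedded trees).

## The family (hands' evidence SOFT-ADDRESS-RECURSION-15237.md, leafhand-4 g17)

GATED COMPOSITION `G ▷ (M₁, M₂)`: a selector mixture `G` on a block `S` (acceptance probability `g`, mean `½`, variance `v_g`,
budget `B_g = Σ_{s∈S} δ̄_s Inf_s[g]`), and mixtures `M₁, M₂` on disjoint blocks (means `½`, variances `v₁,v₂`, budgets `B₁,B₂`);
run `t_g`; if it accepts run `t₁` on `U₁`, else `t₂` on `U₂`; output that answer.  Then `p = g·p₁ + (1−g)·p₂` has mean `½` and,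
with `γ := E g² = ¼ + v_g` (blocks independent, `E[p | x_S] ≡ ½`):

  `Var[p] = γ·(v₁+v₂)`,   `Σⱼ δ̄ⱼ Infⱼ[p] = (v₁+v₂)·B_g + (γ/2)·(B₁+B₂)`,   `r := 16Var²/Σδ̄Inf = 64γ²(v₁+v₂)²/(2(v₁+v₂)B_g + γ(B₁+B₂))`

(selector `s`: `δ̄_s` unchanged, `Inf_s[p] = Inf_s[g]·E(p₁−p₂)² = Inf_s[g](v₁+v₂)`; inner `j ∈ U₁`: `δ̄ⱼ = ½δ̄ⱼ^{(1)}`, `Infⱼ[p] = γ·Infⱼ^{(1)}`).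
Verified by exact enumeration of the cube for `N = 5, 6, 11, 13, 14`.  Building blocks: `leaf` (read one bit, output it:
`(v,B,r) = (¼,1,1)`), `D_m` (read one of `m` bits uniformly, output it: `(1/(4m), 1/m², 1)`), `G_m := D_m ▷ (leaf,leaf)`
(`r = (m+1)²/(m²+m+2)`, `G₃` = the `8/7` gadget of `…L2OSSSLowerBound`).

LOWER BOUNDS obtained (all exceed the tree's `8/7 ≈ 1.1429`): `D₃ ▷ (G₂,G₂)` on 11 bits (12 depth-3 trees, weights 1/12):
`(Var, Σδ̄Inf, r) = (1/8, 5/24, 6/5)` — the smallest member beating `8/7`; `D₃ ▷ (G₃,G₃)` (13 bits): `32/27`;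
`D₆ ▷ (D₃▷(G₃,G₃), …)` (16 bits): `196/159 ≈ 1.2327`; optimal single-read chains `m_i ≈ [2,4,9,18,37,74,…]`: `1.2862` (depth 3),
`1.3179` (4), `1.3350` (5), `1.35274` (depth 12) `→ ≈ 1.3529`; with previously built gadgets used AS SELECTORS: `r ≈ 1.67`
(depth ≈ 16).  Hence **any absolute `L²`-OSSS constant is `≥ 1.67`** (numerically; `≥ 6/5` with an 11-bit witness).

WHY NO COUNTEREXAMPLE lives in the family: per level `r'/r = 4γ/(1 + r·B_g/(8γv)) = (1+4v_g)/(1 + 2r v_g²/(r_g γ v))`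
(`B_g = 16v_g²/r_g`) while `v' = (½+2v_g)v`; the gain needs `v_g < 2r_gγv/r`, is at most `≈ exp(2r_gγv/r)` per level, and `Σ v`
over the levels converges (the variance at least halves when `v_g` is small), so the product of gains converges; with selectors
from the family itself the heuristic fixed point `ln r* ≈ 0.3·r*` gives `r* ≈ 1.63–1.7`, matching the numerics.  (A rigorous
bound for the closure is equivalent to the conjecture on this class: the step uses `B_g ≥ 16v_g²/r_g`.)  Along single-read
chains `V_expl := E[(E[p−½ | transcript])²] = 4·Var²` exactly (Cauchy–Schwarz in `Var = E[(f−½)·E[p−½|transcript]]` is tight),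
so the martingale route `16Var² ≤ 4V_expl ≤ C·Σδ̄Inf` is not refuted by the family either.

## This file

The 11-bit witness is out of reach of point-by-point evaluation at the gate (2^11 points × 12 trees), so its certificate
`6/5 ≤ C₀` must be assembled blockwise (`…BlockCalculus.sum_cube_append` on `Fin (3 + (4 + 4))`).  Here are the two blocks'
cube sums, by 16- and 8-point evaluation (`ClassicalCornerL2OSSSLowerBound.sum_cube_succ`), everything inlined (no definitions):

* `G₂` on `{0,1}^4` (selectors `0,1`, data `2,3`; trees `t_s = [x_s ? x₂ : ¬x₃]`, `G = ½Σ_s [t_s accepts] = a·x₂ + (1−a)(1−x₃)`,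
  `a = (x₀+x₁)/2`): `Σ G = 8`, `Σ G² = 7` (`Var = 3/16`), `Σ_x (G(x^{j→1}) − G(x^{j→0}))² = (2,2,6,6)ⱼ`
  (`Inf = (1/8,1/8,3/8,3/8)`), query counts `#{x : j ∈ t_s.queries x} = ((16,0,8,8),(0,16,8,8))_{s,j}` (`δ̄ = (½,½,½,½)`,
  `Σδ̄Inf = ½`, `r(G₂) = 9/8`);
* the soft selector on `{0,1}^3` (`A = (x₀+x₁+x₂)/3`): `Σ A = 4`, `Σ A² = 8/3`, `Σ A(1−A) = 4/3`,
  `Σ_x (A(x^{σ→1}) − A(x^{σ→0}))² = 8/9`.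

With `…BlockCalculus` these give, for `f(y ⧺ (b ⧺ c)) = A(y)G(b) + (1−A(y))G(c)` on `Fin (3+(4+4))`: `Σ f = 1024`, `Σ f² = 768`,
`Σ(Δ_σ f)² = 256/3` (outer selectors), `Σ(Δ f)² = 256/3, 256` (inner selectors / data), query weights `δ̄ = (⅓,⅓,⅓; ¼,…,¼)`,
i.e. `Var = 1/8`, `Σδ̄Inf = 5/24` — the remaining assembly is left to the next hand (signature: the hypothesis shape `hL2` of
`ClassicalCornerL2OSSSLowerBound.l2osss_const_ge_eight_sevenths` `→ 6/5 ≤ C₀`).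

Honest label: calibration data for a conjectured inequality on the classical corner of an open conjecture; no registered stub,
crux or summit is closed.  Sources: R. O'Donnell, M. Saks, O. Schramm, R. Servedio, FOCS 2005, Thm 3.2; R. O'Donnell,
*Analysis of Boolean Functions* (2014) §8.6.
-/

set_option linter.dupNamespace false

noncomputable section

namespace Summit.QuantumAdvantage.QuantumAdvantage.Theorems.SosSandwich

open Finset Function
open Literature.Computability.Complexity

namespace ClassicalCornerGatedComposition

open ClassicalCornerL2OSSSLowerBound (sum_cube_succ sum_cube_zero)

/-! ### The two-selector gadget `G₂` on `{0,1}^4` -/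

/-- **Mass of `G₂`**: `Σ_x G(x) = 8` for `G = ½([x₀ ? x₂ : ¬x₃] + [x₁ ? x₂ : ¬x₃])`, i.e. `E G = ½`. [folklore] -/
theorem sum_gadgetTwo :
    ∑ x : Fin 4 → Bool,
      ((1 / 2 : ℝ) * (if (DecisionTree.query 0 (.query 3 (.leaf true) (.leaf false))
          (.query 2 (.leaf false) (.leaf true)) : DecisionTree 4).eval x = true then (1 : ℝ) else 0) +
        (1 / 2 : ℝ) * (if (DecisionTree.query 1 (.query 3 (.leaf true) (.leaf false))
          (.query 2 (.leaf false) (.leaf true)) : DecisionTree 4).eval x = true then (1 : ℝ) else 0)) = 8 := by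
  simp only [sum_cube_succ, sum_cube_zero]
  simp [DecisionTree.eval]
  norm_num

/-- **Second moment of `G₂`**: `Σ_x G(x)² = 7`, i.e. `Var G = 7/16 − ¼ = 3/16`. [folklore] -/
theorem sum_gadgetTwo_sq :
    ∑ x : Fin 4 → Bool,
      ((1 / 2 : ℝ) * (if (DecisionTree.query 0 (.query 3 (.leaf true) (.leaf false))
          (.query 2 (.leaf false) (.leaf true)) : DecisionTree 4).eval x = true then (1 : ℝ) else 0) +
        (1 / 2 : ℝ) * (if (DecisionTree.query 1 (.query 3 (.leaf true) (.leaf false))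
          (.query 2 (.leaf false) (.leaf true)) : DecisionTree 4).eval x = true then (1 : ℝ) else 0)) ^ 2 = 7 := by
  simp only [sum_cube_succ, sum_cube_zero]
  simp [DecisionTree.eval]
  norm_num

/-- **Squared increments of `G₂`**: `Σ_x (G(x^{j→1}) − G(x^{j→0}))² = (2, 2, 6, 6)ⱼ`, i.e. `Infⱼ[G] = (1/8, 1/8, 3/8, 3/8)`.
[folklore] -/
theorem sum_sq_update_gadgetTwo (j : Fin 4) :
    ∑ x : Fin 4 → Bool,
      (((1 / 2 : ℝ) * (if (DecisionTree.query 0 (.query 3 (.leaf true) (.leaf false))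
          (.query 2 (.leaf false) (.leaf true)) : DecisionTree 4).eval (update x j true) = true then (1 : ℝ) else 0) +
        (1 / 2 : ℝ) * (if (DecisionTree.query 1 (.query 3 (.leaf true) (.leaf false))
          (.query 2 (.leaf false) (.leaf true)) : DecisionTree 4).eval (update x j true) = true then (1 : ℝ) else 0)) -
      ((1 / 2 : ℝ) * (if (DecisionTree.query 0 (.query 3 (.leaf true) (.leaf false))
          (.query 2 (.leaf false) (.leaf true)) : DecisionTree 4).eval (update x j false) = true then (1 : ℝ) else 0) +
        (1 / 2 : ℝ) * (if (DecisionTree.query 1 (.query 3 (.leaf true) (.leaf false))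
          (.query 2 (.leaf false) (.leaf true)) : DecisionTree 4).eval (update x j false) = true then (1 : ℝ) else 0))) ^ 2 =
      ![2, 2, 6, 6] j := by
  fin_cases j <;>
  · simp only [sum_cube_succ, sum_cube_zero]
    simp [DecisionTree.eval]
    norm_num

/-- **Query counts of the `G₂` trees**: `#{x : j ∈ t_s.queries x} = ((16,0,8,8),(0,16,8,8))_{s,j}` for
`t_s = [x_s ? x₂ : ¬x₃]`, i.e. each coordinate has mixture query probability `δ̄ⱼ = ½`. [folklore] -/
theorem card_queries_gadgetTwo (s : Fin 2) (j : Fin 4) :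
    ((Finset.univ.filter fun x : Fin 4 → Bool => j ∈
        ((![DecisionTree.query 0 (.query 3 (.leaf true) (.leaf false)) (.query 2 (.leaf false) (.leaf true)),
            DecisionTree.query 1 (.query 3 (.leaf true) (.leaf false)) (.query 2 (.leaf false) (.leaf true))] :
            Fin 2 → DecisionTree 4) s).queries x).card : ℝ) =
      ![![16, 0, 8, 8], ![0, 16, 8, 8]] s j := by
  rw [Finset.natCast_card_filter]
  fin_cases s <;> fin_cases j <;>
  · simp only [sum_cube_succ, sum_cube_zero]
    norm_num [DecisionTree.queries, Fin.ext_iff]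

/-! ### The three-bit soft selector on `{0,1}^3` -/

/-- **Mass of the soft selector** `A = (x₀+x₁+x₂)/3`: `Σ_x A(x) = 4`. [folklore] -/
theorem sum_softSelector :
    ∑ x : Fin 3 → Bool, (((if x 0 = true then (1 : ℝ) else 0) + (if x 1 = true then (1 : ℝ) else 0) +
      (if x 2 = true then (1 : ℝ) else 0)) / 3) = 4 := by
  simp only [sum_cube_succ, sum_cube_zero]
  simp
  norm_num

/-- **Second moment of the soft selector**: `Σ_x A(x)² = 8/3` (`E A² = ⅓ = ¼ + 1/12`). [folklore] -/
theorem sum_softSelector_sq :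
    ∑ x : Fin 3 → Bool, (((if x 0 = true then (1 : ℝ) else 0) + (if x 1 = true then (1 : ℝ) else 0) +
      (if x 2 = true then (1 : ℝ) else 0)) / 3) ^ 2 = 8 / 3 := by
  simp only [sum_cube_succ, sum_cube_zero]
  simp
  norm_num

/-- **Mixed moment of the soft selector**: `Σ_x A(x)(1 − A(x)) = 4/3`. [folklore] -/
theorem sum_softSelector_mul_one_sub :
    ∑ x : Fin 3 → Bool, (((if x 0 = true then (1 : ℝ) else 0) + (if x 1 = true then (1 : ℝ) else 0) +
      (if x 2 = true then (1 : ℝ) else 0)) / 3) * (1 - ((if x 0 = true then (1 : ℝ) else 0) +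
      (if x 1 = true then (1 : ℝ) else 0) + (if x 2 = true then (1 : ℝ) else 0)) / 3) = 4 / 3 := by
  simp only [sum_cube_succ, sum_cube_zero]
  simp
  norm_num

/-- **Squared increments of the soft selector**: `Σ_x (A(x^{σ→1}) − A(x^{σ→0}))² = 8/9` for each `σ`. [folklore] -/
theorem sum_sq_update_softSelector (σ : Fin 3) :
    ∑ x : Fin 3 → Bool,
      ((((if update x σ true 0 = true then (1 : ℝ) else 0) + (if update x σ true 1 = true then (1 : ℝ) else 0) +
          (if update x σ true 2 = true then (1 : ℝ) else 0)) / 3) -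
        (((if update x σ false 0 = true then (1 : ℝ) else 0) + (if update x σ false 1 = true then (1 : ℝ) else 0) +
          (if update x σ false 2 = true then (1 : ℝ) else 0)) / 3)) ^ 2 = 8 / 9 := by
  fin_cases σ <;>
  · simp only [sum_cube_succ, sum_cube_zero]
    simp
    norm_num

end ClassicalCornerGatedComposition

end Summit.QuantumAdvantage.QuantumAdvantage.Theorems.SosSandwich

end
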